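import Summits.Ventures.CertifiedArithmetic.LowPrec.Representable
import Literature.ComputerArithmetic.FloatingPoint.RoundInt

/-!
# Round-to-nearest-even on the magnitude grid of a minifloat format

HONEST FRAMING (venture CertifiedArithmetic / cell `pub-lowprec`): certified error envelopes and
provably optimal rounding/accumulation schemes for low-precision formats under stated cost models;
every table by two implementations; no hardware or vendor claims.

`Format.rneGrid φ r : ℕ` rounds a nonnegative rational magnitude `r` (in quanta) to the grid of
finite magnitudes of `φ`: nearest multiple of the local spacing `2^(shift ⌊r⌋)`, ties to the even
multiple, then SATURATION at `maxScaled` [RouhaniEtAl2023MX, §3]. Proved here, at grid level: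
the result is representable (`rneGrid_representable`), NEAREST among representable magnitudes
(`abs_sub_rneGrid_le`), TIES TO EVEN (`two_dvd_of_tie`, with the parity transported to the
trailing significand by `two_dvd_manOf_rneMult`), within half the local spacing when in range
(`abs_sub_rneGrid_le_half_spacing`), and saturating (`rneGrid_eq_maxScaled_of_le`).
File `Round.lean` lifts these to signed rationals and `MiniFloat` data.

Placement: venture development under `Summits/Ventures/CertifiedArithmetic/`; declarations are
dot-notation extensions of the Literature structures `Format` / `MiniFloat` and carry their
absolute `Literature.ComputerArithmetic.FloatingPoint.…` names (CONVENTIONS §2).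
-/

namespace Literature.ComputerArithmetic.FloatingPoint

namespace Format

variable (φ : Format)

/-- RNE of a nonnegative rational magnitude `r` (in quanta) onto the magnitude grid of `φ`,
saturating at `maxScaled`: round `r` to the nearest multiple of the local spacing
`2^(shift ⌊r⌋)`, ties to the even multiple, then clamp. [cite: IEEE7542019, §4.3.1] -/
def rneGrid (r : ℚ) : ℕ :=
  min ((rneInt (r / 2 ^ φ.shift ⌊r⌋.toNat)).toNat * 2 ^ φ.shift ⌊r⌋.toNat) φ.maxScaled

variable {φ}

/-- `rneGrid r ≤ maxScaled`. [folklore] -/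
theorem rneGrid_le_maxScaled (r : ℚ) : φ.rneGrid r ≤ φ.maxScaled := min_le_right _ _

/-- Representable magnitudes at or above `2^(m+s)` are multiples of `2^s`. [folklore] -/
theorem pow_dvd_of_representable {n s : ℕ} (hn : φ.Representable n)
    (hle : 2 ^ (φ.manBits + s) ≤ n) : 2 ^ s ∣ n := by
  obtain ⟨-, k, j, hk, rfl⟩ := MiniFloat.representable_iff.mp hn
  have hsj : s ≤ j := by
    by_contra hlt
    have hlt : j < s := not_le.mp hlt
    have : k * 2 ^ j < 2 ^ (φ.manBits + 1) * 2 ^ j := Nat.mul_lt_mul_of_pos_right hk (by positivity)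
    have h2 : 2 ^ (φ.manBits + 1) * 2 ^ j ≤ 2 ^ (φ.manBits + s) := by
      rw [← pow_add]; exact Nat.pow_le_pow_right (by norm_num) (by omega)
    omega
  obtain ⟨c, hc⟩ := Nat.pow_dvd_pow 2 hsj
  exact ⟨k * c, by rw [hc]; ring⟩

/-- The unclamped RNE multiple of the local spacing. [folklore] -/
def rneMult (φ : Format) (r : ℚ) : ℕ :=
  (rneInt (r / 2 ^ φ.shift ⌊r⌋.toNat)).toNat * 2 ^ φ.shift ⌊r⌋.toNat

/-- `rneGrid = min rneMult maxScaled`. [folklore] -/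
theorem rneGrid_eq_min (r : ℚ) : φ.rneGrid r = min (φ.rneMult r) φ.maxScaled := rfl

/-- For `r ≥ 0`, `⌊r⌋.toNat ≤ r`. [folklore] -/
theorem floor_toNat_le {r : ℚ} (hr : 0 ≤ r) : ((⌊r⌋.toNat : ℕ) : ℚ) ≤ r := by
  have h0 : 0 ≤ ⌊r⌋ := Int.floor_nonneg.mpr hr
  have : ((⌊r⌋.toNat : ℕ) : ℤ) = ⌊r⌋ := Int.toNat_of_nonneg h0
  calc ((⌊r⌋.toNat : ℕ) : ℚ) = ((⌊r⌋.toNat : ℕ) : ℤ) := by push_cast; rfl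
    _ = ⌊r⌋ := by rw [this]
    _ ≤ r := Int.floor_le r

/-- `r < ⌊r⌋.toNat + 1`. [folklore] -/
theorem lt_floor_toNat_add_one (r : ℚ) : r < ((⌊r⌋.toNat : ℕ) : ℚ) + 1 := by
  have h1 : r < ⌊r⌋ + 1 := Int.lt_floor_add_one r
  have h2 : ⌊r⌋ ≤ ((⌊r⌋.toNat : ℕ) : ℤ) := Int.self_le_toNat ⌊r⌋
  have h3 : (⌊r⌋ : ℚ) ≤ ((⌊r⌋.toNat : ℕ) : ℚ) := by exact_mod_cast h2
  linarith

/-- A natural-number bound `N ≤ ⌊r⌋.toNat` transfers to `N ≤ r`. [folklore] -/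
theorem natCast_le_of_le_floor_toNat {r : ℚ} (hr : 0 ≤ r) {N : ℕ} (h : N ≤ ⌊r⌋.toNat) :
    (N : ℚ) ≤ r :=
  le_trans (by exact_mod_cast h) (floor_toNat_le hr)

/-- A strict bound `⌊r⌋.toNat < N` transfers to `r < N`. [folklore] -/
theorem lt_natCast_of_floor_toNat_lt {r : ℚ} {N : ℕ} (h : ⌊r⌋.toNat < N) : r < (N : ℚ) := by
  have h1 := lt_floor_toNat_add_one r
  have h2 : ((⌊r⌋.toNat : ℕ) : ℚ) + 1 ≤ N := by exact_mod_cast h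
  linarith

/-- Dichotomy for the local spacing exponent `s = shift ⌊r⌋`: either `s = 0`, or the binade floor
`2^(m+s)` lies below `r`. [folklore] -/
theorem shift_floor_dichotomy {r : ℚ} (hr : 0 ≤ r) :
    φ.shift ⌊r⌋.toNat = 0 ∨ ((2 : ℚ) ^ (φ.manBits + φ.shift ⌊r⌋.toNat) ≤ r) := by
  by_cases h : ⌊r⌋.toNat < 2 ^ (φ.manBits + 1)
  · exact Or.inl (shift_eq_zero_of_lt h)
  · right
    have hge : 2 ^ φ.manBits ≤ ⌊r⌋.toNat := by rw [pow_succ] at h; omega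
    have := pow_shift_le (φ := φ) hge
    exact_mod_cast natCast_le_of_le_floor_toNat hr this

/-- Below the top binade, `r < 2^(m+1+s)`. [folklore] -/
theorem lt_pow_of_shift_floor_lt {r : ℚ} (hs : φ.shift ⌊r⌋.toNat < φ.emaxCode - 1) :
    r < (2 : ℚ) ^ (φ.manBits + 1 + φ.shift ⌊r⌋.toNat) := by
  have := lt_pow_shift (φ := φ) hs
  exact_mod_cast lt_natCast_of_floor_toNat_lt this

/-- The RNE quotient is nonnegative for `r ≥ 0`. [folklore] -/
theorem rneInt_div_nonneg {r : ℚ} (hr : 0 ≤ r) (s : ℕ) : 0 ≤ rneInt (r / 2 ^ s) :=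
  rneInt_nonneg (div_nonneg hr (by positivity))

/-- Cast of `rneMult`: `(rneMult r : ℚ) = rneInt (r / 2^s) · 2^s`. [folklore] -/
theorem rneMult_cast {r : ℚ} (hr : 0 ≤ r) :
    (φ.rneMult r : ℚ) = (rneInt (r / 2 ^ φ.shift ⌊r⌋.toNat) : ℚ) * 2 ^ φ.shift ⌊r⌋.toNat := by
  unfold rneMult
  have h0 := rneInt_div_nonneg hr (φ.shift ⌊r⌋.toNat)
  have : (((rneInt (r / 2 ^ φ.shift ⌊r⌋.toNat)).toNat : ℕ) : ℤ) = rneInt (r / 2 ^ φ.shift ⌊r⌋.toNat) :=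
    Int.toNat_of_nonneg h0
  push_cast
  rw [← this]
  rfl

/-- `rneMult r` is at least as close to `r ≥ 0` as any multiple of the local spacing. [folklore] -/
theorem abs_sub_rneMult_le_mul {r : ℚ} (hr : 0 ≤ r) (k : ℕ) :
    |r - φ.rneMult r| ≤ |r - (k : ℚ) * 2 ^ φ.shift ⌊r⌋.toNat| := by
  rw [rneMult_cast hr]
  have := abs_sub_rneInt_mul_le r (c := (2 : ℚ) ^ φ.shift ⌊r⌋.toNat) (by positivity) k
  simpa using this

/-- `rneMult r` is at least as close to `r ≥ 0` as any representable magnitude. [folklore] -/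
theorem abs_sub_rneMult_le {r : ℚ} (hr : 0 ≤ r) {n' : ℕ} (hn' : φ.Representable n') :
    |r - φ.rneMult r| ≤ |r - n'| := by
  by_cases hdvd : 2 ^ φ.shift ⌊r⌋.toNat ∣ n'
  · obtain ⟨k, hk⟩ := hdvd
    have := abs_sub_rneMult_le_mul (φ := φ) hr k
    rw [hk]; push_cast; rw [mul_comm]; exact this
  · -- n' lies below the binade floor 2^(m+s) ≤ r
    have hlt : n' < 2 ^ (φ.manBits + φ.shift ⌊r⌋.toNat) := by
      by_contra hge
      exact hdvd (pow_dvd_of_representable hn' (not_lt.mp hge))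
    rcases shift_floor_dichotomy (φ := φ) hr with hs | hfloor
    · exact absurd (by rw [hs]; exact one_dvd _) hdvd
    · have h1 := abs_sub_rneMult_le_mul (φ := φ) hr (2 ^ φ.manBits)
      have e : ((2 ^ φ.manBits : ℕ) : ℚ) * 2 ^ φ.shift ⌊r⌋.toNat
          = (2 : ℚ) ^ (φ.manBits + φ.shift ⌊r⌋.toNat) := by push_cast; ring
      rw [e] at h1
      rw [abs_of_nonneg (show (0 : ℚ) ≤ r - 2 ^ (φ.manBits + φ.shift ⌊r⌋.toNat) by linarith)]
        at h1
      have hlt' : (n' : ℚ) < (2 : ℚ) ^ (φ.manBits + φ.shift ⌊r⌋.toNat) := by exact_mod_cast hlt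
      rw [abs_of_nonneg (by linarith : (0 : ℚ) ≤ r - n')]
      linarith

/-- In the unclamped case the RNE quotient is below `2^(m+1)`, or equals it (carry into the next
binade). [folklore] -/
theorem rneInt_div_le {r : ℚ} (hr : 0 ≤ r) (hle : φ.rneMult r ≤ φ.maxScaled) :
    (rneInt (r / 2 ^ φ.shift ⌊r⌋.toNat)).toNat ≤ 2 ^ (φ.manBits + 1) ∧
      ((rneInt (r / 2 ^ φ.shift ⌊r⌋.toNat)).toNat = 2 ^ (φ.manBits + 1) →
        φ.shift ⌊r⌋.toNat < φ.emaxCode - 1) := by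
  set s := φ.shift ⌊r⌋.toNat with hs_def
  have h0 := rneInt_div_nonneg hr s
  rcases Nat.lt_or_ge s (φ.emaxCode - 1) with hs | hs
  · have hr' : r / 2 ^ s ≤ ((2 ^ (φ.manBits + 1) : ℕ) : ℤ) := by
      have := lt_pow_of_shift_floor_lt (φ := φ) hs
      rw [div_le_iff₀ (by positivity)]
      push_cast
      rw [← pow_add]; exact this.le
    have := rneInt_le_of_le hr'
    constructor
    · omega
    · intro; exact hs
  · -- top binade: rneMult ≤ maxScaled ≤ (2^m + topMan) 2^s forces q ≤ 2^m + topMan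
    have hs' : s = φ.emaxCode - 1 := le_antisymm (shift_le _) hs
    have hmax : φ.maxScaled ≤ (2 ^ φ.manBits + φ.topMan) * 2 ^ s := by
      rw [hs']
      unfold maxScaled scaled
      split
      · have := φ.topMan_lt
        calc φ.topMan ≤ (2 ^ φ.manBits + φ.topMan) * 1 := by omega
          _ ≤ (2 ^ φ.manBits + φ.topMan) * 2 ^ (φ.emaxCode - 1) :=
            Nat.mul_le_mul_left _ Nat.one_le_two_pow
      · exact le_rfl
    have hq : (rneInt (r / 2 ^ s)).toNat ≤ 2 ^ φ.manBits + φ.topMan := by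
      have : (rneInt (r / 2 ^ s)).toNat * 2 ^ s ≤ (2 ^ φ.manBits + φ.topMan) * 2 ^ s :=
        le_trans hle hmax
      exact Nat.le_of_mul_le_mul_right this (by positivity)
    have := φ.topMan_lt
    constructor
    · rw [pow_succ]; omega
    · intro h; rw [pow_succ] at h; omega

/-- The unclamped RNE multiple, when within range, is representable. [folklore] -/
theorem rneMult_representable {r : ℚ} (hr : 0 ≤ r) (hle : φ.rneMult r ≤ φ.maxScaled) :
    φ.Representable (φ.rneMult r) := by
  obtain ⟨hq, hcarry⟩ := rneInt_div_le hr hle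
  rcases Nat.lt_or_ge (rneInt (r / 2 ^ φ.shift ⌊r⌋.toNat)).toNat (2 ^ (φ.manBits + 1)) with h | h
  · exact MiniFloat.representable_mul_pow h hle
  · have heq : (rneInt (r / 2 ^ φ.shift ⌊r⌋.toNat)).toNat = 2 ^ (φ.manBits + 1) := le_antisymm hq h
    have : φ.rneMult r = 1 * 2 ^ (φ.manBits + 1 + φ.shift ⌊r⌋.toNat) := by
      unfold rneMult; rw [heq, ← pow_add, one_mul]
    rw [this]
    exact MiniFloat.representable_mul_pow (Nat.one_lt_two_pow (by omega)) (this ▸ hle)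

/-- `rneGrid r` is representable (for `r ≥ 0`). [folklore] -/
theorem rneGrid_representable {r : ℚ} (hr : 0 ≤ r) : φ.Representable (φ.rneGrid r) := by
  rw [rneGrid_eq_min]
  rcases le_total (φ.rneMult r) φ.maxScaled with h | h
  · rw [min_eq_left h]; exact rneMult_representable hr h
  · rw [min_eq_right h]; exact MiniFloat.representable_maxScaled φ

/-- If clamping happens then `r ≥ maxScaled`. [folklore] -/
theorem maxScaled_le_of_clamp {r : ℚ} (hr : 0 ≤ r) (h : φ.maxScaled < φ.rneMult r) :
    (φ.maxScaled : ℚ) ≤ r := by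
  by_contra hlt
  have hlt : r < φ.maxScaled := not_le.mp hlt
  have h1 := abs_sub_rneMult_le hr (MiniFloat.representable_maxScaled φ)
  have h2 : (φ.maxScaled : ℚ) < φ.rneMult r := by exact_mod_cast h
  rw [abs_of_nonpos (by linarith : r - φ.rneMult r ≤ 0),
    abs_of_nonpos (by linarith : r - φ.maxScaled ≤ 0)] at h1
  linarith

/-- NEAREST on the grid: `rneGrid r` is at least as close to `r ≥ 0` as any representable
magnitude. [cite: IEEE7542019, §4.3.1] -/
theorem abs_sub_rneGrid_le {r : ℚ} (hr : 0 ≤ r) {n' : ℕ} (hn' : φ.Representable n') :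
    |r - φ.rneGrid r| ≤ |r - n'| := by
  rw [rneGrid_eq_min]
  rcases le_or_gt (φ.rneMult r) φ.maxScaled with h | h
  · rw [min_eq_left h]; exact abs_sub_rneMult_le hr hn'
  · rw [min_eq_right h.le]
    have hr' := maxScaled_le_of_clamp hr h
    have hn'le : (n' : ℚ) ≤ φ.maxScaled := by
      obtain ⟨x, rfl⟩ := hn'; exact_mod_cast x.scaledMag_le_maxScaled
    rw [abs_of_nonneg (by linarith), abs_of_nonneg (by linarith)]
    linarith

/-- TIES TO EVEN on the grid: if a representable `n' ≠ rneGrid r` is equally near to `r ≥ 0`,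
then no clamping occurred and the RNE quotient is even. [cite: IEEE7542019, §4.3.1] -/
theorem two_dvd_of_tie {r : ℚ} (hr : 0 ≤ r) {n' : ℕ} (hn' : φ.Representable n')
    (heq : |r - n'| = |r - φ.rneGrid r|) (hne : n' ≠ φ.rneGrid r) :
    φ.rneMult r ≤ φ.maxScaled ∧ 2 ∣ rneInt (r / 2 ^ φ.shift ⌊r⌋.toNat) := by
  have hn'le : (n' : ℚ) ≤ φ.maxScaled := by
    obtain ⟨x, rfl⟩ := hn'; exact_mod_cast x.scaledMag_le_maxScaled
  rw [rneGrid_eq_min] at heq hne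
  rcases le_or_gt (φ.rneMult r) φ.maxScaled with h | h
  · rw [min_eq_left h] at heq hne
    refine ⟨h, ?_⟩
    by_cases hdvd : 2 ^ φ.shift ⌊r⌋.toNat ∣ n'
    · obtain ⟨k, hk⟩ := hdvd
      have hc : (0 : ℚ) < 2 ^ φ.shift ⌊r⌋.toNat := by positivity
      apply two_dvd_rneInt_of_tie (r / 2 ^ φ.shift ⌊r⌋.toNat) (k := k)
      · -- divide the tie by the spacing
        rw [rneMult_cast hr, hk] at heq
        push_cast at heq
        have e1 : r - 2 ^ φ.shift ⌊r⌋.toNat * (k : ℚ)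
            = (r / 2 ^ φ.shift ⌊r⌋.toNat - k) * 2 ^ φ.shift ⌊r⌋.toNat := by field_simp
        have e2 : r - (rneInt (r / 2 ^ φ.shift ⌊r⌋.toNat) : ℚ) * 2 ^ φ.shift ⌊r⌋.toNat
            = (r / 2 ^ φ.shift ⌊r⌋.toNat - rneInt (r / 2 ^ φ.shift ⌊r⌋.toNat))
              * 2 ^ φ.shift ⌊r⌋.toNat := by field_simp
        rw [e1, e2, abs_mul, abs_mul, abs_of_pos hc] at heq
        have := mul_right_cancel₀ (ne_of_gt hc) heq
        exact_mod_cast this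
      · intro hkq
        apply hne
        unfold rneMult
        rw [hk, ← hkq, mul_comm]
        simp
    · exfalso
      have hlt : n' < 2 ^ (φ.manBits + φ.shift ⌊r⌋.toNat) := by
        by_contra hge
        exact hdvd (pow_dvd_of_representable hn' (not_lt.mp hge))
      rcases shift_floor_dichotomy (φ := φ) hr with hs | hfloor
      · exact hdvd (by rw [hs]; exact one_dvd _)
      · have h1 := abs_sub_rneMult_le_mul (φ := φ) hr (2 ^ φ.manBits)
        have e : ((2 ^ φ.manBits : ℕ) : ℚ) * 2 ^ φ.shift ⌊r⌋.toNat
            = (2 : ℚ) ^ (φ.manBits + φ.shift ⌊r⌋.toNat) := by push_cast; ring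
        rw [e] at h1
        rw [abs_of_nonneg (show (0 : ℚ) ≤ r - 2 ^ (φ.manBits + φ.shift ⌊r⌋.toNat) by linarith)]
          at h1
        have hlt' : (n' : ℚ) < (2 : ℚ) ^ (φ.manBits + φ.shift ⌊r⌋.toNat) := by exact_mod_cast hlt
        rw [abs_of_nonneg (by linarith : (0 : ℚ) ≤ r - n')] at heq
        linarith
  · exfalso
    rw [min_eq_right h.le] at heq hne
    have hr' := maxScaled_le_of_clamp hr h
    have hlt : (n' : ℚ) < φ.maxScaled := lt_of_le_of_ne hn'le (by exact_mod_cast hne)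
    rw [abs_of_nonneg (by linarith), abs_of_nonneg (by linarith)] at heq
    linarith

/-- The error of `rneGrid` at `r ≥ 0` within range is at most half the local spacing.
[folklore] -/
theorem abs_sub_rneGrid_le_half_spacing {r : ℚ} (hr : 0 ≤ r) (hle : r ≤ φ.maxScaled) :
    |r - φ.rneGrid r| ≤ 2 ^ φ.shift ⌊r⌋.toNat / 2 := by
  have hc : (0 : ℚ) < 2 ^ φ.shift ⌊r⌋.toNat := by positivity
  -- no clamping when r ≤ maxScaled: maxScaled is a multiple of the spacing lying above r
  have hno : φ.rneMult r ≤ φ.maxScaled := by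
    have hdv : 2 ^ φ.shift ⌊r⌋.toNat ∣ φ.maxScaled := by
      rcases shift_floor_dichotomy (φ := φ) hr with hs | hfloor
      · rw [hs]; exact one_dvd _
      · exact pow_dvd_of_representable (MiniFloat.representable_maxScaled φ)
          (by exact_mod_cast le_trans hfloor hle)
    obtain ⟨M, hM⟩ := hdv
    have hrM : r / 2 ^ φ.shift ⌊r⌋.toNat ≤ ((M : ℕ) : ℤ) := by
      rw [div_le_iff₀ hc]; push_cast
      calc r ≤ φ.maxScaled := hle
        _ = (M : ℚ) * 2 ^ φ.shift ⌊r⌋.toNat := by rw [hM]; push_cast; ring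
    have hq := rneInt_le_of_le hrM
    unfold rneMult; rw [hM, mul_comm (2 ^ _) M]
    apply Nat.mul_le_mul_right; omega
  rw [rneGrid_eq_min, min_eq_left hno, rneMult_cast hr]
  have h3 := abs_sub_rneInt_le_half (r / 2 ^ φ.shift ⌊r⌋.toNat)
  have e2 : r - (rneInt (r / 2 ^ φ.shift ⌊r⌋.toNat) : ℚ) * 2 ^ φ.shift ⌊r⌋.toNat
      = (r / 2 ^ φ.shift ⌊r⌋.toNat - rneInt (r / 2 ^ φ.shift ⌊r⌋.toNat))
        * 2 ^ φ.shift ⌊r⌋.toNat := by field_simp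
  rw [e2, abs_mul, abs_of_pos hc]
  calc |r / 2 ^ φ.shift ⌊r⌋.toNat - rneInt (r / 2 ^ φ.shift ⌊r⌋.toNat)| * 2 ^ φ.shift ⌊r⌋.toNat
      ≤ 1 / 2 * 2 ^ φ.shift ⌊r⌋.toNat := mul_le_mul_of_nonneg_right h3 hc.le
    _ = 2 ^ φ.shift ⌊r⌋.toNat / 2 := by ring

/-- Parity transport: in the unclamped case an even RNE quotient yields an even trailing
significand (formats with `m ≥ 1`). [folklore] -/
theorem two_dvd_manOf_rneMult {r : ℚ} (hr : 0 ≤ r) (hle : φ.rneMult r ≤ φ.maxScaled)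
    (h2 : 2 ∣ rneInt (r / 2 ^ φ.shift ⌊r⌋.toNat)) (hm : 1 ≤ φ.manBits) :
    2 ∣ φ.manOf (φ.rneMult r) := by
  set s := φ.shift ⌊r⌋.toNat with hs_def
  set q := (rneInt (r / 2 ^ s)).toNat with hq_def
  have hq0 := rneInt_div_nonneg hr s
  have h2q : 2 ∣ q := by
    obtain ⟨c, hc⟩ := h2
    refine ⟨c.toNat, ?_⟩
    rw [hq_def, hc]; omega
  have hn0 : φ.rneMult r = q * 2 ^ s := rfl
  obtain ⟨hqle, hcarry⟩ := rneInt_div_le hr hle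
  have h2m : 2 ∣ 2 ^ φ.manBits := dvd_pow_self 2 (by omega)
  unfold manOf
  split
  · -- small result: man = q 2^s
    rw [hn0]; exact Dvd.dvd.mul_right h2q _
  · rename_i hge
    have hge : 2 ^ φ.manBits ≤ φ.rneMult r := not_lt.mp hge
    -- q ≥ 2^m
    have hqm : 2 ^ φ.manBits ≤ q := by
      rcases shift_floor_dichotomy (φ := φ) hr with hs0 | hfloor
      · have hs0' : s = 0 := by rw [hs_def]; exact hs0
        have : φ.rneMult r = q := by rw [hn0, hs0', pow_zero, mul_one]
        rw [this] at hge; exact hge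
      · have : ((2 ^ φ.manBits : ℕ) : ℤ) ≤ rneInt (r / 2 ^ s) := by
          apply le_rneInt_of_le
          rw [le_div_iff₀ (by positivity)]; push_cast
          rw [← pow_add]; exact hfloor
        omega
    rcases Nat.lt_or_ge q (2 ^ (φ.manBits + 1)) with hlt | hge'
    · -- q = 2^m + T with T < 2^m: shift (q 2^s) = s
      have hT : q - 2 ^ φ.manBits < 2 ^ φ.manBits := by rw [pow_succ] at hlt; omega
      have hshift : φ.shift (φ.rneMult r) = s := by
        rw [hn0, show q = 2 ^ φ.manBits + (q - 2 ^ φ.manBits) by omega]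
        exact shift_scaled_succ hT (shift_le _)
      rw [hshift, hn0, Nat.mul_div_cancel _ (by positivity)]
      omega
    · -- carry: q = 2^(m+1), result 2^(m+1+s) = (2^m + 0) 2^(s+1)
      have hq : q = 2 ^ (φ.manBits + 1) := le_antisymm hqle hge'
      have hs1 : s + 1 ≤ φ.emaxCode - 1 := by have := hcarry hq; omega
      have hval : φ.rneMult r = (2 ^ φ.manBits + 0) * 2 ^ (s + 1) := by
        rw [hn0, hq]; ring
      have hshift : φ.shift (φ.rneMult r) = s + 1 := by
        rw [hval]; exact shift_scaled_succ (by positivity) hs1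
      rw [hshift, hval, Nat.mul_div_cancel _ (by positivity)]
      simp

/-- At or beyond the largest magnitude the grid rounding saturates. [folklore] -/
theorem rneGrid_eq_maxScaled_of_le {r : ℚ} (h : (φ.maxScaled : ℚ) ≤ r) :
    φ.rneGrid r = φ.maxScaled := by
  have hr : 0 ≤ r := le_trans (by positivity) h
  have h1 := abs_sub_rneGrid_le hr (MiniFloat.representable_maxScaled φ)
  have h2 : (φ.rneGrid r : ℚ) ≤ φ.maxScaled := by exact_mod_cast rneGrid_le_maxScaled r
  rw [abs_of_nonneg (by linarith), abs_of_nonneg (by linarith)] at h1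
  exact_mod_cast le_antisymm h2 (by linarith)

end Format

end Literature.ComputerArithmetic.FloatingPoint
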